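import Summits.HodgeConjecture.HodgeConjecture.Theorems.KummerModuliPrimeLevelAssembly
import Summits.Ventures.HodgeKum4.Theorems.KummerFixedLocusI2Closing
import Summits.Ventures.HodgeKum4.Theorems.KummerFixedLocusTangentDischarged
import HarnessLib
import HarnessLib.Audit

/-!
# KummerModuliKumFourClosure — the `n = 4` Kummer moduli spaces `K_H(v)`: the Hodge conjecture for `K` and all its powers from REFEREED print + F125X (print-synthesis) + T1 + Bülles, modulo ONE explicit hypothesis at `K` — the involution parity "LEMMA P" (T3 of the crux idea) — and NO L1 ∕ L2′ (kernel theorems; nothing asserted)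

Summit `HodgeConjecture/HodgeConjecture`; seat `vhodge-19149-w3`; third file of the crux idea
`kummer-moduli-invariants-by-markman-on-m` (after `Theorems/KummerModuliInvariantsByMarkmanOnM.lean` — invariant
half from T1 + Markman ∕ Bülles ON `M_H(v)` — and `Theorems/KummerModuliPrimeLevelAssembly.lean` — prime-level
assembly modulo the Gram datum `hI`).  FILING ANCHOR `--supports stmt-HodgeConjecture-19149` (director's
instruction); MATHEMATICAL TARGET = the `K_H(v)` rung `Theorems.HC_KummerSheafModuliSpace` at `n = 4`; NO bearing
on Weil sixfolds.  HONEST FRAMING: kernel theorems from NAMED hypotheses; the one non-fact hypothesis is `hP`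
(below); nothing here asserts `HodgeConjecture`, `HC_AV`, `W₆`, `HC_Kum4Type`, `HC_KummerSheafModuliSpace` or the
Hodge conjecture for any single `K_H(v)`.

## What is proved (K = kernel)

* `exists_gram_of_facts_at` — **the Gram datum `I(4)` AT ONE `Kum⁴`-type variety `X`** (an algebraic `w ∈ H⁸`
  and `φ` with `φ(ρ(g)w) = 1` for `1 ≠ g ∈ Γ(X)`, `φ(w) ≠ 1`) from the refereed facts (A1) Hirzebruch's
  `G`-signature theorem, (A2) Floccari 2026 fixed fourfold, (A3) Voisin Hodge index ∕ Hodge–Riemann (tree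
  THEOREM `Voisin2002_hodgeIndex_hodgeRiemann_middle_holds`) + Göttsche–Soergel, (A4) GKLR + Foster, (F_Γ)
  `|Γ| = 625`, Fulton, the geometric residual I1geo (`Kum4FixedFourfoldMeetsTranslates`, a `∀`-statement the
  kum4 cell derives from Floccari–Varesco + F125X: `kum4FixedFourfoldMeetsTranslates_of_split125'`), and **(A5)
  AT `X` ONLY**: every automorphism `ι` with `ι^* = +1` on `H²`, `−1` on `H³` fixes the `Γ(X)`-invariant
  classes of `H⁸(X(ℂ); ℂ)`.  This is the kum4 cell's `kum4FixedFourfoldClasses_of_facts`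
  (`KummerFixedLocusI2Closing`, seat p2) with its `∀ X`-hypothesis `hA5` LOCALISED to the variety at hand —
  proof copied line for line (adapted; credited), because on a Kummer MODULI space the parity (A5) is the crux
  idea's LEMMA P (Markman-on-`M`: `ι_M^* = (−1)^{deg}` on the Künneth generators), available at `K_H(v)` and
  NOT on a general `Kum⁴`-type `X` (where the cell discharges it by L1).
* `hodgeConjectureFor_kumFour_of_involutionParity` — **for every `4`-dimensional-index Kummer moduli space
  `K = K_H(v)` (`IsKummerSheafModuliSpace 4 A K`, `dim K = 8`): (A1)–(A4), (F_Γ) via Floccari–Varesco, Fulton,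
  Foster (all `n`), Arapura, T1 (Yoshioka), Bülles — ALL REFEREED — plus F125X (PRINT-SYNTHESIS,
  `HassettTschinkel2013_Oguiso2020_fixedPointScheme_translation_kum4Type`) plus the ONE explicit hypothesis `hP`
  (LEMMA P's conclusion at `K`) imply the Hodge conjecture for `K` and all its powers.**  Route: `hP` ⟹ `I(4)`
  at `K` (`exists_gram_of_facts_at`) ⟹ `IsDominatedByPowers 8 K 2 A` (`isDominatedByPowers_of_gram`, `4 + 1`
  prime; invariant half by T1 + Bülles) ⟹ HC (Arapura + `HC(Aᵏ)`).  Compare route №1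
  (`route-Ventures-KummerFixedLocus`): HC for EVERY `Kum⁴`-type `X` modulo L1 ∧ L2′ ∧ print ∧ F125X; here, on
  the Kummer-moduli loci, L1 and L2′ are replaced by T1 + Bülles + `hP` — the card's consequence (2), by name.
* Sequel `Theorems/KummerModuliKumFourParityClosure.lean`: the same with `hP` DERIVED (companion file
  `Theorems/KummerModuliInvolutionParity.lean`, T1 (+ T2)) from LEMMA P's cohomological intermediate `hpar`
  (resp. its untwisted generator-level core `hgeo`) on a presentation `K ≅ f⁻¹(t) ↪ M`.

## The hypothesis `hP` (T3, "LEMMA P" — NOT a fact, NOT proved here)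

`hP : ∀ ι : Aut K, ι^*|_{H²} = 𝟙 → ι^*|_{H³} = −𝟙 → ∀ c ∈ H⁸(K(ℂ); ℂ), IsGammaInvariant K c → ι^* c = c`.
Seat derivation on record (hodge-lit-oqh-1 g8, `vhodge/lit-oqh/staging/hodge-lit-oqh-1/OQH3-RESTATEMENT-oqh1-g8.md`
§LEMMA P, to be refereed ×2): `ι_M : E ↦ (−1_A)^* E` composed with a translation preserves `K`, acts on
`H*(M; ℚ)` by `(−1)^{deg}` because it does so on Markman's generators (T2, `eq_top_of_abelianSurface`), hence
fixes `Im(H⁸(M) → H⁸(K)) ⊇ H⁸(K)^Γ` (T1); any other such `ι` differs by an element of `Γ(K)`.  Typing it as a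
kernel theorem needs the universal-property ∕ `ch`-functoriality plumbing for the universal sheaf (not here); its
Markman half and its "differ by `Γ(K)`" half ARE kernel (`Theorems/KummerModuliInvolutionParity.lean`), leaving the
cohomological intermediate `hpar` (resp. the untwisted generator-level core `hgeo`) — consumed in the sequel
`Theorems/KummerModuliKumFourParityClosure.lean`.

## What this is NOT

Not a proof of HC for any `K_H(v)`; `hP` is undischarged and F125X is print-synthesis.  Not a statement about
`Kum⁴`-type varieties off the Kummer-moduli loci.  No new definition, no new named fact.
-/

noncomputable section

open CategoryTheory MonoidalCategory
open Literature.AlgebraicTopology.SingularHomology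
open Literature.AlgebraicGeometry Literature.AlgebraicGeometry.HodgeTheory Literature.AlgebraicGeometry.ModuliOfSheaves
open Literature.AlgebraicGeometry.Hyperkaehler (IsOfGeneralizedKummerType translationRep translationRepReal
  totalPullback Floccari2026_fixedFourfold_kum4Type Floccari2026_card_autFixingH2H3_kum4Type Foster2024_translationAction_kum4Type
  Foster2024_translationAction_kumType FloccariVaresco2024_autFixingH2H3_equiv_kumType
  GreenKimLazaRobles2022_llvTrivial_isOfHodgeType_kumType GoettscheSoergel1993_chiY_kum4Type
  HassettTschinkel2013_Oguiso2020_fixedPointScheme_translation_kum4Type)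
open Literature.AlgebraicGeometry.Motives (SchemeOver AbelianVariety IsSmoothProjective)
open Summit.Ventures.HodgeKum4

-- `Summit.<Summit>.<Problem>` is the mandated summit-side namespace (CONVENTIONS §2); for the
-- single-conjunct summit `HodgeConjecture` the two coincide, so the duplicate is deliberate.
set_option linter.dupNamespace false

namespace Summit.HodgeConjecture.HodgeConjecture.Theorems.KummerModuliMarkmanOnM

/-- **The Gram datum `I(4)` at ONE smooth projective `Kum⁴`-type variety `X`, from refereed print + I1geo +
the involution parity (A5) AT `X`.**  The kum4 cell's `kum4FixedFourfoldClasses_of_facts` with `hA5` localised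
to `X` (proof adapted line for line from `Summits/Ventures/HodgeKum4/Theorems/KummerFixedLocusI2Closing.lean`,
seat p2): `φ = ε'·⟨w ∪ ·, [X]⟩` for the algebraic class `w` of Floccari's fixed fourfold, `φ(ρ(g)w) = 1`
(`g ≠ 1`, I1geo + Fulton), `φ(w) = ±Sign(ι, X) = ±6 ≠ 1` (Hirzebruch + Hodge–Riemann + (A5)).  Conditional on
the named facts; nothing is proved outright. [cite: Floccari2026, Lemma 4.2 and Prop. 4.6]
[cite: Hirzebruch1969SignatureRamifiedCoverings, (6)] [cite: HassettTschinkel2013, Prop. 4.3 (the model, n = 2)] -/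
theorem exists_gram_of_facts_at
    (hA1 : Hirzebruch1969_gSignature_involution_halfDimFixedLocus)
    (hA2 : Floccari2026_fixedFourfold_kum4Type)
    (hHIR : Voisin2002_hodgeIndex_hodgeRiemann_middle)
    (hGS : GoettscheSoergel1993_chiY_kum4Type)
    (hGK : GreenKimLazaRobles2022_llvTrivial_isOfHodgeType_kumType)
    (hF : Foster2024_translationAction_kum4Type)
    (hcardF : Floccari2026_card_autFixingH2H3_kum4Type)
    (hFu : Fulton1998_cupPairing_transversalPoint) (hgeo : Kum4FixedFourfoldMeetsTranslates)
    {X : SchemeOver ℂ} (hX : IsSmoothProjective 8 X) (hK : IsOfGeneralizedKummerType 4 X)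
    (hA5 : ∀ ι : Aut X, complexBetti.map ι.hom 2 = 𝟙 _ → complexBetti.map ι.hom 3 = -𝟙 _ →
      ∀ c : complexBetti X 8, IsGammaInvariant X c → (complexBetti.map ι.hom 8).hom c = c) :
    ∃ (w : complexBetti X 8) (φ : complexBetti X 8 →ₗ[ℂ] ℂ), w ∈ algebraicClasses X 4 ∧
      (∀ g : autFixingH2H3 X, g ≠ 1 → φ (middleRep X g w) = 1) ∧ φ w ≠ 1 := by
  -- adapted from Summits/Ventures/HodgeKum4/Theorems/KummerFixedLocusI2Closing.lean
  -- (`kum4FixedFourfoldClasses_of_facts`, cell hodge-kum4 seat p2), with `hA5` localised to `X`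
  -- (A2) the Kummer involution and its fixed locus: a Kummer fixed datum `hD`
  obtain ⟨ι, W, i, hD⟩ := hA2 hX hK
  obtain ⟨hι2, hιH2, hιH3, hιΓ, hW, -, hi, hifix, K', hKf, G, dG, iG, hG, hdG, hiG, hGG, hWG,
    hfixlocus⟩ := id hD
  -- the complex orientations and the integral Poincaré dual of `W`
  set μ : HomologicalOrientation ℤ (Motives.ComplexPoints X) 16 := complexOrientationInt hX with hμ
  set ν : HomologicalOrientation ℤ (Motives.ComplexPoints W) 8 := complexOrientationInt hW with hν
  obtain ⟨w, hw⟩ := exists_int_pdClass hX hW i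
  set wR : singularCohomology ℝ ℝ (Motives.ComplexPoints X) 8 :=
    singularCohomology.ringChange (algebraMap ℤ ℝ) (Motives.ComplexPoints X) 8 w with hwR
  set wC : complexBetti X 8 :=
    singularCohomology.ringChange (algebraMap ℤ ℂ) (Motives.ComplexPoints X) 8 w with hwC
  have hwRpd := real_pd_of_int_pd hX hW i hw
  have hwalg : wC ∈ algebraicClasses X 4 := ringChange_int_pdClass_mem_algebraicClasses hX hW i hw
  set s : ℤ := cupPairing μ (rfl : 8 + 8 = 16) w w with hs
  -- (A1) the `G`-signature theorem: `Sign(ι, X) = ⟨w_ℝ ∪ w_ℝ, [X]_ℝ⟩ = s`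
  have hA1' := hA1.dim8 hX μ ι hι2 Unit K' (fun _ => W) G dG (fun _ => hW) hG
    (fun k => lt_of_le_of_lt (hdG k) (by norm_num)) (fun _ => i) iG (fun _ => hi) hiG
    (fun j j' hjj' => absurd (Subsingleton.elim j j') hjj') hGG (fun _ k => hWG k)
    (by rw [Set.iUnion_const]; exact hfixlocus) (fun _ => ν) (fun _ => wR) (fun _ => hwRpd)
  rw [Fintype.sum_unique] at hA1'
  have hBww : (cupProduct (R := ℝ) (X := Motives.ComplexPoints X) (rfl : 8 + 8 = 16)).compr₂
      ((kroneckerPairing ℝ ℝ (Motives.ComplexPoints X) 16).flip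
        (singularHomology.coeffChange (Motives.ComplexPoints X)
          (algebraMap ℤ ℝ : ℤ →+* ℝ).toAddMonoidHom 16 μ.fundamentalClass)) wR wR = (s : ℝ) :=
    kroneckerPairing_cup_ringChange_real (rfl : 8 + 8 = 16) μ w w
  have hsig : sig ((realPairing X μ).compl₂ (realBetti.map ι.hom 8).hom) = s := by
    have h : ((sig ((realPairing X μ).compl₂ (realBetti.map ι.hom 8).hom) : ℤ) : ℝ) = (s : ℝ) := by
      rw [← hBww, ← hA1', sig]
      push_cast
      rfl
    exact_mod_cast h
  have hself : complexPairingWith X μ wC wC = s := by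
    rw [complexPairingWith_apply]
    exact kroneckerPairing_cup_ringChange_complex (rfl : 8 + 8 = 16) μ w w
  -- (A3) Hodge index / Hodge–Riemann in `ε`-form
  obtain ⟨ε, hε, hHI, hHR⟩ := hHIR.dim8 hX μ
  obtain ⟨A⟩ := nonempty_hodgeModel_holds (n := 8) (X := X) hX
  have hσ : sig (realPairing X μ) = ε * 630 := by
    have h := hHI A
    rw [hGS.signatureSum_eq_fst hX hK A] at h
    exact h
  -- (A4) `ε B > 0` on `𝒦ℝ ∖ 0`
  have hpos : ∀ x ∈ Representation.Coinvariants.ker (middleRepReal X), x ≠ 0 →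
      0 < (ε : ℝ) * realPairing X μ x x := by
    intro x hx hx0
    rw [middleRepReal_eq_lit] at hx
    exact hHR x hx0 (isOfHodgeType_ringChange_of_mem_coinvariantsKer hGK hF hX hK hx)
      (cup_ringChange_eq_zero_of_mem_coinvariantsKer hF hX hK hx)
  -- (A5) AT `X`: `ι^*` fixes the `Γ`-invariant real middle classes
  have hfix : ∀ x ∈ (middleRepReal X).invariants, (realBetti.map ι.hom 8).hom x = x := by
    intro x hx
    refine map_real_eq_self_of_complex ι (hA5 ι hιH2 hιH3) x fun g hg => ?_
    have h := hx (⟨g, hg⟩⁻¹ : autFixingH2H3 X)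
    rw [middleRepReal_apply, inv_inv] at h
    exact h
  -- (F_Γ) `|Γ| = 625`, odd; `dim 𝒦ℝ ≤ 624`
  have hcard : Nat.card (autFixingH2H3 X) = 625 := hcardF hX hK
  have hodd : Odd (Nat.card (autFixingH2H3 X)) := by rw [hcard]; exact ⟨312, rfl⟩
  have hdim : Module.finrank ℝ (Representation.Coinvariants.ker (middleRepReal X)) ≤ 624 := by
    rw [middleRepReal_eq_lit]
    exact (hF hX hK).2.1
  -- (A0) `Γ` preserves `[X]_ℝ`
  have hμΓ : ∀ g : Aut X, g ∈ autFixingH2H3 X →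
      singularHomology.map ℝ ℝ (Motives.AlgPoints.mapContinuous (L := ℂ) g.hom) 16
        (realFundamentalClass X μ) = realFundamentalClass X μ :=
    fun g hg => map_realFundamentalClass_eq_self_of_odd_card hX (complexOrientationInt hX)
      (autFixingH2H3 X) hodd g hg
  -- (I1R) on the datum `hD`
  obtain ⟨ε', hε', hI1'⟩ := kum4FixedFourfoldTranslatesR_of_meetsTranslates hFu hgeo hX hK ι hW i hD w hw
  -- assemble
  exact kum4FixedFourfoldClasses_clause_of_eps hX μ ι hι2 hιΓ wC hwalg s hsig hself
    (cupProduct_gradedComm_holds ℝ (Motives.ComplexPoints X)) hμΓ hcard hdim ε hε hpos hfix hσ ε' hε' hI1'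

/-- **THE `n = 4` KUMMER-MODULI CLOSURE OF THE CRUX IDEA, by name: for every Kummer moduli space `K = K_H(v)` of
`Kum⁴`-type (`IsKummerSheafModuliSpace 4 A K`), REFEREED print — Hirzebruch (A1), Floccari 2026 (A2),
Göttsche–Soergel, GKLR, Foster (all `n`), Floccari–Varesco (`Γ ≅ (ℤ/5)⁴`), Fulton, Arapura, Yoshioka (T1), Bülles,
with the tree THEOREMS Voisin Hodge index ∕ Hodge–Riemann and Milne's tangent-dimension fact — plus F125X
(PRINT-SYNTHESIS) plus ONE explicit hypothesis `hP` (the involution parity at `K`, "LEMMA P" = T3 of the card)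
imply the Hodge conjecture for `K` and for all its powers.**  No L1, no L2′, no Kuga–Satake ∕ O'Grady input.
Chain: `hP` ⟹ `I(4)` at `K` (`exists_gram_of_facts_at`, I1geo by `kum4FixedFourfoldMeetsTranslates_of_split125'`)
⟹ `IsDominatedByPowers 8 K 2 A` (`isDominatedByPowers_of_gram`, `5` prime; invariant half by T1 + Bülles)
⟹ HC (`IsKummerSheafModuliSpace.hodgeConjectureFor_of_isDominatedByPowers`: Arapura + `HC(Aᵏ)`).
CONDITIONAL on every named fact and on `hP`; NOT a proof of the Hodge conjecture for any `K_H(v)`.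
[cite: Arapura2006, Lemma 4.2] [cite: Yoshioka2001AbelianSurfaces, §4.1] [cite: Bulles2020, Thm. 0.1]
[cite: Floccari2026, Lemma 4.2 and Prop. 4.6] [cite: Hirzebruch1969SignatureRamifiedCoverings, (6)] [cite: Foster2024, Remark 88]
[cite: FloccariVaresco2024, §3] -/
theorem hodgeConjectureFor_kumFour_of_involutionParity
    (hA1 : Hirzebruch1969_gSignature_involution_halfDimFixedLocus)
    (hA2 : Floccari2026_fixedFourfold_kum4Type)
    (hGS : GoettscheSoergel1993_chiY_kum4Type)
    (hGK : GreenKimLazaRobles2022_llvTrivial_isOfHodgeType_kumType)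
    (hF : Foster2024_translationAction_kumType) (hFV : FloccariVaresco2024_autFixingH2H3_equiv_kumType)
    (hFu : Fulton1998_cupPairing_transversalPoint)
    (hA42 : Arapura2006_hodgeClasses_algebraic_of_isDominatedByPowers)
    (hY : Yoshioka2001_kummerFibre_restrictionImage) (hB : Bulles2020_sheafModuli_isDominatedByPowers_surface)
    (h125 : HassettTschinkel2013_Oguiso2020_fixedPointScheme_translation_kum4Type)
    {A : AbelianVariety ℂ} {K : SchemeOver ℂ} (hKv : IsKummerSheafModuliSpace 4 A K)
    (hP : ∀ ι : Aut K, complexBetti.map ι.hom 2 = 𝟙 _ → complexBetti.map ι.hom 3 = -𝟙 _ →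
      ∀ c : complexBetti K 8, IsGammaInvariant K c → (complexBetti.map ι.hom 8).hom c = c) :
    HodgeConjectureFor 8 K ∧ ∀ m : ℕ, HodgeConjectureFor ((m + 1) * 8) (K.pow (m + 1)) := by
  have hI := exists_gram_of_facts_at hA1 hA2 Voisin2002_hodgeIndex_hodgeRiemann_middle_holds hGS hGK
    (hF.kum4Type hFV) hFV.floccari2026_card hFu (kum4FixedFourfoldMeetsTranslates_of_split125' hFV h125)
    hKv.isSmoothProjective hKv.isOfGeneralizedKummerType hP
  exact hodgeConjectureFor_of_gram hA42 hY hB hF hFV (n := 4) (by norm_num) (by norm_num) hKv hI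

end Summit.HodgeConjecture.HodgeConjecture.Theorems.KummerModuliMarkmanOnM

end
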